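import Summits.BirchSwinnertonDyer.Rank1Residual.F1Sign2.CongruenceLocalGaugeAtTwo

/-!
# Cell `bsd-f1-sign2`, lens `-desc` g14 (MEMO-desc §22): THE PARITY-TRANSFER SYMBOL IS A GROUPOID COCYCLE — `u` of the glued pair is the Kummer
# class of the rational point `(0, c)`, Green–Maistret's `λ_{f,v}` IS Kramer's intersection parity times `(−1,−1)_v`, and §21's local gauge law
# (G)+(R) is a theorem on paper — rows DESC-§22-U, -K, -Z (§B), -L (LEAD), -L∞ (§C), -A, -C, -C∞ (§D)

SIBLING MODULE of the landed `F1Sign2/CongruenceLocalGaugeAtTwo.lean` (p616822 = Sketch-v17 = Sketch-v18 §A verbatim: carriers `gmCurve`,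
`gmPartner`, `gmL`, `gmDisc`, `gmGaugeAt`, `gmGaugeInfty`, `IsGMCongruence`, rows DESC-§21-G/R/N/D, PROVED `exists_isGMCongruence`): imports it and
restates nothing. -desc asked for ONE module (D-desc-ty-22); the §21 module carries proofs and is at 305/400 lines (p619561), §B–§D are ≈ 160 lines,
so they live here (-desc 08:52:04Z and REF1 §86: NO OBJECTION). STATEMENTS ONLY: eight plain `def … : Prop` (nothing asserted; kinds in the docstrings: U/K/Z/A support theorem-grade, L/L∞
theorem on paper, C/C∞ conjecture-grade as typed over the explicit dictionary, theorem on paper); no `instance`, no `notation`, no named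
Literature fact, no `sorry`.

TYPER FILING (seat `bsd-f1-sign2-ty` g8; CANDIDATES.md rows DESC-§22-U/K/Z/L/L∞/A/C/C∞; -desc g14 CANDIDATES-delta 2026-08-28T08:31:05Z «file
§B–§D AFTER the REF1 pass»): bodies VERBATIM from `HOME/MEMO-desc-data/g14/lean/Sketch-v18.lean` af2ae69e4ff628d8 l.153–314 (-desc: lean check
rc 0 · 0 err · 0 warn · 0 sorry; BC7 `#h21_crux_probe` 8/8 CLEAN `lean/Probe-v18.verdicts.txt`) — builder `tools/mk_desc22.py` (published with the
filed text under `HOME/MEMO-ty-data/g8/`) applies: this header (the planner's proof summary kept verbatim below) and the REF1, REF2 verdict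
paragraphs; cite keys checked against `references.bib` (`DokchitserDokchitser2011Crelle`, `KlagsbrunMazurRubin2013` = Disparity paper,
`PoonenRains2012`, `GreenMaistret2022`, `BrumerKramer1977`, `Kramer1981`).
REF1-AUDIT §86 (refuter seat bsd-f1-sign2-ref1 g8, 2026-08-28T09:09:13Z; D-desc-ref1-22 ANSWERED; evidence `HOME/REF1-data/b86/`: Probe86.lean
f7a147de2774e12e farm rc 0 · 0 warn · 0 sorry, axioms trio; this draft 1524f36df905e1f5 recompiled rc 0, rows 8/8 SAME token-for-token vs Sketch-v18):
**-ty FILING GATE CLEARED.** Verdicts: (U) `ThetaDiscrepancyOfGluedPairAtTwo`, (K) `GluedPairDiscrepancyIsKummerClassAtTwo`, (Z)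
`GluedPairCorrectionBitVanishesAtTwo`, (A) `TransvectionRulingFormulaF2` = THEOREMS IN THE KERNEL (-desc g14 `GluedPairIdentity.lean` a33a3d2596811eee,
`Transvection.lean` d1332845eae42874; compat certificates bb1da82a9e01754b, 05e4558dbde9aafe recompiled by REF1 rc 0, axioms propext, Classical.choice,
Quot.sound) — CLEARED to land WITH PROOFS (the `…Proofs` sibling modules close these four rows BY NAME); (L), (L∞) = THEOREM ON PAPER (GM Thm 2.11 ×
THEOREM 2, every step checked against GM Def. 1.11, Lemma 2.3, step (b) = Bruin 2004 Thm 3.1(c) × the §20 dictionary × row Z), CLEARED as plain defs,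
grade VARIANT, in-print assembly, corollary-grade (agreeing with REF2); (C), (C∞) = THEOREM ON PAPER over the explicit dictionary, CLEARED conjecture-grade
AS TYPED — the `𝔽₂` core (LEMMA A + THEOREM 3 + Dickson step) verified EXHAUSTIVELY by an independent brute force (Lemma A n = 1,2,3: 36/3 600/32 400
= 36 036 cases, decomposition bit well defined in every case; Theorem 3 n = 1,2: 216 + 216 000 exhaustive, n = 3: 40 000 sampled; Dickson 19 901; 0
violations) and THEOREM 1 by an exact polynomial certificate (`thm1_check.out` 310af08b8cfe319f); composite-ψ convention for the third symbol RIGHT (e7,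
kernel). BC7: -desc censuses j303550 (91 237/91 237 place rows, defect ≠ 0 in 13 656) and j304246 accepted; §83 rider g2 DISCHARGED. Riders r1–r7 are
docstring-level (no row text change) and are folded into the row docstrings below (r6 concerns the Proofs sibling). PARTITION: none; beyond-print
theorem: U/K/Z no (elementary VARIANT support, kernel) · A no (known type, kernel) · L/L∞ no (in-print assembly; the SENTENCE «λ_{f,K}·(−1,−1)_K =
Kummer intersection parity» is unprinted) · C/C∞ yes-small, corollary-grade (theorem on paper, not in the kernel; no new GLOBAL parity content).
REF2-PLACEMENT v20-add1 §2 (72c43a195162eaf0, 2026-08-28T08:49Z/08:50Z; D-desc-ref2-22 (a)(b)(c) answered, riders r1–r4 folded into the docstrings below):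
**-L (+L∞) = VARIANT, IN-PRINT ASSEMBLY (corollary-grade)** — the Kummer step Im δ_{φᵗ} = W_E + ψ^*W_{E′} is Bruin 2004 (Math. Comp. 73) Thm 3.1(c) (any m,
any field of characteristic 0; global Selmer identities S^{(φ)}(A) = S²(E) + S²(E′), S^{(φ̂)}(E×E′) = S²(E) ∩ S²(E′), §1); with #E(K)/2E(K) = #E(K)[2]·‖2‖_K⁻¹,
(−1,−1)_K = (−1)^{[K:ℚ₂]} and the ker/coker normalisation of λ (GM 2022 Def 1.11 = Dokchitser–Maistret 2023 §1.3) the identity follows in three lines;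
not printed as a sentence (GM compute λ via Tamagawa numbers, Lemma 2.6); it identifies the constant (−1,−1)_v as a change of normalisation and does NOT
explain GM's 𝓔_K(f) (their remark after Thm 2.11 stands, r3); to be landed with a proof as a theorem, not as a candidate. **-A = KNOWN-type** (classical 𝔽₂
quadratic-form algebra: two rulings of maximal isotropic subspaces, Dickson invariant d_q(σ) = dim V^σ mod 2 — Dye 1977, Morgan 2019 A&NT 13 Prop 10;
Pollatsek 1971 / Morgan 2019 Construction 11 for Sp(V)). **-C (+C∞) = NEW-COMBINATION (small)** — «parity 1-cochain whose coboundary is the pairing of the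
form-change classes» is in print for the symplectic GROUP (Morgan 2019 Prop 14, df_q = c_q ∪ c_q, after Pollatsek 1971), applied to 2-Selmer disparity in
quadratic-twist families; Klagsbrun–Mazur–Rubin 2013 Thm 3.9 = the u = 1 case; the groupoid-of-congruences form (distinct curves with E[2] ≅ M, form-change
classes = Poonen–Rains theta discrepancies, defect read as conic isotropy) not found verbatim; Σ_v⟨u₁₂,u₂₃⟩_v = 0 is reciprocity (no new global parity
content); beyond-print theorem yes-small (corollary-grade) pending REF1's proof audit. **-U, -K, -Z = VARIANT-type support rows** (gluing along 2-torsion: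
Frey–Kani, Bruin 2004 §4–5, Bruin–Doerksen 2011 Lemma 8) — land with proofs (-desc g14 `GluedPairIdentity.lean` a33a3d2596811eee has them; they follow
this module as a sibling `…Proofs` module). r4: Bruin's global Selmer identities are available for a global row if wanted. PARTITION: none.
LANDING RECORD (-ty g8): this module p620234 (2026-08-28T09:13:50Z); rows U (p620606 `ParitySymbolCocycleAtTwoProofsGluedPair.lean`) and K, Z, A
(p621018 `ParitySymbolCocycleAtTwoProofs.lean`) PROVED by name from -desc g14's kernel files; REF2 v21 (d4b89a80d4f0f089) §1 + v21-add1
(b12a8350a0adedf5) §1 folded text-only into rows C, C∞, L below (joint REF1+REF2 line for C/C∞: NEW-COMBINATION (small), beyond-print theorem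
yes-small, corollary-grade, on paper); statement bodies byte-identical to p620234.
APPEND (-ty g8): §B-add = rows DESC-§22-V `ThetaDiscrepancySquareIffMarkedPointHalvesAtTwo`, DESC-§22-V′ `ThetaDiscrepancyDetectsPartnerRankAtTwo`
+ PROVED support `gmPartner_nonsingular_markedPoint` (-desc g14 Sketch-v19V 805b155533ae6839, MEMO-desc §22.13 Thm 4(iii)(iv)); see the §B-add section docstring.
CENSUS / BC5 (-desc g14; kit tag bsd-frontier-data): **j303550** (16 cores, 310 s; smoke j303408): 22 190 congruent Cremona TRIPLES (302 S₃-fields,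
4 239 curves, N ≤ 98 480) — cocycle law DESC-§22-C **91 237/91 237 place rows**, defect ≠ 0 in 13 656 rows (∞ 2 113 / 2: 3 310 / odd 8 233) =
exactly where naive additivity fails, two defect engines (nfhilbert × 2 = polarisation) agree 91 237/91 237, reciprocity 22 190/22 190, errors 0;
§B rows on the §20/§21 tables (j302066, j302686): every pair with d ∈ ℚ^{×2} has u_v ∈ δ_v(F) and c_v = 0 at every place — 98 519 place rows,
0 exceptions; DESC-§22-A brute force (bruteA) 0/63 644 violations for dim V ≤ 4 + 20 000 samples at dim V = 6. Cheapest falsifiers: one triple and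
place with the cocycle identity failing (C); one square-d pair with c_v ≠ 0 (Z) → 0 → NOT KILLED. WHY NOVEL (-desc §22): identifies REF2 v19
§2's «NOT FOUND» constant cocycle (−1,−1)_v as the parity of the Kummer excess dim E(K)/2E(K) − dim E(K)[2] and makes the §20 symbol a groupoid
cocycle with defect = local Tate pairing of transported discrepancies — the lens' answer to the cell's question («the signed object at 2 =
(−1)^{dim E(ℚ_v)/2E(ℚ_v) − dim E(ℚ_v)[2]}, −1 exactly at 2 and ∞»). PARTITION: none moved; beyond-print theorem: -desc claims YES (two small
theorems on paper, §22.3/§22.4) pending -ref1, -ref2. bears_on: the cell's search question (descent lens); DESC-§21-G/R become theorems on paper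
via L + C + DESC-§20-T + DD 2011 Thm 5.

Planner's summary (verbatim, -desc g14 Sketch-v18 module docstring):
WHAT IS PROVED ON PAPER IN §22 (MEMO-desc §22.2–§22.6).  Let `E₁ ~ E₂` be a `2`-congruence (`ψ₁₂ : L₂ → L₁`, `M = E₁[2] ≅ E₂[2]`),
`u₁₂ ∈ ker N = H¹(ℚ, M)` its theta-discrepancy, `K = ℚ_v`, `V = H¹(K, M)` with the (common) local Tate pairing `⟨·,·⟩` and the
Poonen–Rains forms `q₁`, `q₂ = q₁ + ⟨u₁₂,·⟩`, `Wᵢ = δ_v(Eᵢ)` (`qᵢ`-Lagrangians), `κ_v = d_v + c_v` the §20 local parity symbol.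
(A) TRANSVECTION FORMULA (pure `𝔽₂`-linear algebra, row `TransvectionRulingFormulaF2`): `τ_u(x) = x + ⟨x,u⟩u` is an isometry
`(V,q₂) → (V,q₁)` and `dim(W₁ ∩ τ_u W₂) = dim(W₁ ∩ W₂) + c_v`; hence `κ_v ≡ n − dim(W₁ ∩ τ_u W₂)` is the RULING DISTANCE of the two
`q₁`-Lagrangians `W₁`, `τ_u W₂` (choice-free meaning of the correction bit).
(B) COCYCLE LAW (row `LocalParitySymbolCocycleAtTwo`): for `E₁ ~ E₂ ~ E₃` (compatible `ψ`'s), at every place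
`κ_v(E₁,E₃) ≡ κ_v(E₁,E₂) + κ_v(E₂,E₃) + [⟨u₁₂,u₂₃⟩_v = −1]`, and `⟨u₁₂,u₂₃⟩_v = q_{E₁,v}(ψ₁₂ u₂₃)` (polarisation; `q(u_{1j}) = 0` by
DESC-§20-I) = `[the conic S_{ψ₁₂u₂₃, E₁} is anisotropic over ℚ_v]`; `∏_v` of the defect is `1` (reciprocity).  Proof: `τ_uτ_wτ_{u+w}` is the
Dickson-`0` element `x ↦ x + ⟨x,w⟩u + ⟨x,u⟩w` of `O(q₁)` if `⟨u,w⟩ = 0` and the reflection `τ_w ∈ O(q₁)` (Dickson `1`) if `⟨u,w⟩ = 1`.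
(C) THE GLUED PAIR (rows `ThetaDiscrepancyOfGluedPairAtTwo`, `GluedPairDiscrepancyIsKummerClassAtTwo`, `GluedPairCorrectionBitVanishesAtTwo`):
for the Green–Maistret pair `(E_f, E′_f)` (`d = 1`), `u = −ψ(θ_{E′})·(c_E′(θ_E)/2)²` EXACTLY, i.e. `u` is the Kummer class of the
rational point `T₀ = (0, c) ∈ E′_f(ℚ)` transported by `ψ`; so `u_v ∈ δ_v(E′_f)` and `c_v(E_f,E′_f) = 0` at every place.
(D) `λ = KRAMER PARITY × (−1,−1)` (row `GreenMaistretLambdaIsKramerParityAtTwo`): for the `(2,2)`-isogeny `φ : E × E′ → Jac C_f`,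
`C_f : y² = f(x²)`, with kernel the graph of `ψ` (GM Lemma 2.3), Kummer naturality gives `Im δ_{φᵗ,K} = W_E + ψ^*W_{E′}` and
`#ker φᵗ(K) = #M(K)`, whence `ord₂(#coker/#ker)(φᵗ|_K) = d_K + e_K`, `e_K := dim E(K)/2E(K) − dim E(K)[2] = ord₂‖2‖_K⁻¹`
(`[K:ℚ₂]`, `0`, `−1` at `2`-adic, odd, real `K`), `(−1)^{e_K} = (−1,−1)_K`, and `μ_{C_f/K} = 1` (`∞± ∈ C_f(K)`): GM's Def. 1.11 local
term is `λ_{f,K} = (−1)^{d_K(E_f,E′_f)}·(−1,−1)_K` — the «constant cocycle» of §21 is the parity of `dim E(K)/2E(K) − dim E(K)[2]`.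
With GM Thm 2.11 this PROVES (G) at `d = 1`; with (B) applied to `E_f ~ E′_{f_r} ~ (E′_{f_r})^{(d)}` (second step a twist, `u = 1`, DESC-§20-T)
and Kramer–Tunnell (Dokchitser² 2011 Thm 5) it proves (G)+(R) for every `(f,d)`, i.e. v17's rows G and R, which stay as typed.
CENSUS = BC5 witness: kit j303408/j303550 (triples; cocycle law place-row by place-row with the defect from two engines), §20/§21 tables
(98 519 place rows with `d ∈ ℚ^{×2}`: `u_v ∈ δ_v(F)` and `c_v = 0` everywhere, 0 exceptions).  Statements only (`def … : Prop`); nothing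
asserted; no `sorry`; no `instance`; no new notation.  Carriers are the tree's (`F1Sign2/ThetaDiscrepancyParityAtTwo.lean`, p610974/p612509).
-/

noncomputable section

open scoped Classical TensorProduct

open WeierstrassCurve Polynomial NumberField IsDedekindDomain Literature.NumberTheory.QuadraticForms

namespace Summit.BirchSwinnertonDyer.Rank1Residual.F1Sign2

/-! ## §B (g14). The glued pair `(E_f, E′_f)`: `u` is the Kummer class of `T₀ = (0,c) ∈ E′_f(ℚ)`; the correction bit vanishes -/

/-- **DESC-§22-U (support; theorem-grade, ELEMENTARY IDENTITY in `L_E = ℚ[X]/c_E` — provable now).** For the Green–Maistret pair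
`E = E_f = ⟨0,a,0,b,c⟩`, `F = E′_f = ⟨0,b,0,ac,c²⟩` (`c ≠ 0`) and `ψ` pinned by `ψ(θ_F)·θ_E = 16c` (roots `θ_E = 4α`, `θ_F = 4c/α`):
`u_{E,F} · (−c·θ_E) = (2c · c_E′(θ_E))²`, i.e. `u = −ψ(θ_F)·(c_E′(θ_E)/2)² = [−cα]` modulo squares.  (Computation: `c_F′(16c/θ) =
−4c·c_E′(θ)/θ` from `c_E(θ) = 0`.)  Meaning: `u` is the image under `ψ` of the Kummer class `[X(T₀) − θ_F] = [−θ_F]` of the RATIONAL POINT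
`T₀ = (0, c)` of `E′_f` (on `Y² = c_F(X)`: `X = 0`, `Y = 8c`); equivalently, for the datum `(f_r, d)`, `u = [f(r)(r − α)]` = the class of the
rational point `(r, 1)` on the twist `f(r)·y² = f(x)`. **PROVED**: `thetaDiscrepancyOfGluedPairAtTwo_holds` in `F1Sign2/ParitySymbolCocycleAtTwoProofsGluedPair.lean` (p620606; REF1 §86 «theorem in the
kernel», -desc g14 proof, axioms propext, Classical.choice, Quot.sound); NON-VACUOUS for every `a b c` (REF1 §86 e9 `e9_exists_pinned_congruence`, `ψ(θ_F) := −¼(θ_E² + 4aθ_E + 16b)`); binders `c ≠ 0`, `ψ`, pin carry no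
`Fact`s. THEOREM 1 of MEMO-desc §22.2 certified exactly by REF1 (`thm1_check.out` 310af08b8cfe319f). [cite: GreenMaistret2022, Remark 2.2, Lemma 6.3] -/
def ThetaDiscrepancyOfGluedPairAtTwo : Prop :=
  ∀ (a b c : ℤ), c ≠ 0 →
    ∀ (ψ : twoDivisionAlgebra (gmPartner a b c) →ₐ[ℚ] twoDivisionAlgebra (gmCurve a b c)),
      ψ (twoDivisionRoot (gmPartner a b c)) * twoDivisionRoot (gmCurve a b c) =
        algebraMap ℚ (twoDivisionAlgebra (gmCurve a b c)) (16 * c : ℚ) →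
      thetaDiscrepancyAtTwo (gmCurve a b c) (gmPartner a b c) ψ *
          (algebraMap ℚ (twoDivisionAlgebra (gmCurve a b c)) (-(c : ℚ)) * twoDivisionRoot (gmCurve a b c)) =
        (algebraMap ℚ (twoDivisionAlgebra (gmCurve a b c)) (2 * c : ℚ) * twoDivisionDifferent (gmCurve a b c)) ^ 2

/-- **DESC-§22-K (support; theorem-grade, elementary — provable now from DESC-§22-U with the witness `s = {0}`, `β = −θ_F`).**
For the glued pair the theta-discrepancy lies in the TRANSPORTED LOCAL KUMMER IMAGE of `F = E′_f` at EVERY prime and at the real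
place: `u ≡ ψ(−θ_F) = ψ([X(T₀) − θ_F])`, `T₀ = (0,c) ∈ E′_f(ℚ)` (`c_F(0) = 64c² ∈ ℚ^{×2}`).  Census (BC5): every pair of the §20/§21
tables with `d ∈ ℚ^{×2}` has `u_v ∈ δ_v(F)` at every place (j302066: 12 820 + 757 pairs; j302686: 8 561 pairs; 98 519 place rows; 0 exceptions).
**PROVED**: `gluedPairDiscrepancyIsKummerClassAtTwo_holds` in `F1Sign2/ParitySymbolCocycleAtTwoProofs.lean` (p621018; -desc `GluedPairIdentity.lean`
a33a3d2596811eee verbatim; REF1 §86 «theorem in the kernel»; standard axioms); rider r1: the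
hypothesis `gmDisc a b c ≠ 0` is DECORATION here (unused by the kernel proof; kept for uniformity — load-bearing only where `Δ_f` enters `𝓔`, row L);
the two `Fact (Irreducible …)` binders are load-bearing and satisfiable (e.g. `f = x³ − x + 1`); the rows type `ψ` over `DivisionRing.toRatAlgebra`, the
carriers over `AdjoinRoot.instAlgebra` — definitionally equal instances (REF1: real but harmless; provers bind `(ψ) (hpin)` before the Facts).
[cite: BrumerKramer1977, §2] [cite: GreenMaistret2022, Remark 2.2] -/
def GluedPairDiscrepancyIsKummerClassAtTwo : Prop :=
  ∀ (a b c : ℤ), c ≠ 0 → gmDisc a b c ≠ 0 →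
    ∀ [Fact (Irreducible (twoDivisionUCubic (gmCurve a b c)))] [Fact (Irreducible (twoDivisionUCubic (gmPartner a b c)))]
      (ψ : twoDivisionAlgebra (gmPartner a b c) →ₐ[ℚ] twoDivisionAlgebra (gmCurve a b c)),
      ψ (twoDivisionRoot (gmPartner a b c)) * twoDivisionRoot (gmCurve a b c) =
        algebraMap ℚ (twoDivisionAlgebra (gmCurve a b c)) (16 * c : ℚ) →
      (∀ (p : ℕ) [Fact p.Prime],
          InTransportedKummerImageAtTwo (gmCurve a b c) (gmPartner a b c) ψ p
            (thetaDiscrepancyAtTwo (gmCurve a b c) (gmPartner a b c) ψ)) ∧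
        InRealKummerImageAtTwo (gmCurve a b c) (twoDivisionUCubic (gmPartner a b c)) (ψ (twoDivisionRoot (gmPartner a b c)))
          (thetaDiscrepancyAtTwo (gmCurve a b c) (gmPartner a b c) ψ)

/-- **DESC-§22-Z (support; theorem-grade: immediate from DESC-§22-K and the definition of the correction bit in
`IsLocalParitySymbolAt` — `c = 0` as soon as `u ∈ δ_v(F)`).** THE CORRECTION BIT OF THE GLUED PAIR VANISHES at every prime and at `∞`:
`κ_v(E_f, E′_f) = d_v(E_f, E′_f)` is Kramer's intersection term.  (So in (G) at `d = 1` the descent symbol is `(−1)^{d_v}` and the content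
of §21's law is DESC-§22-L.) Census: `c_v = 0` in all 98 519 square-`d` place rows of j302066/j302686. REF1 §86 rider r2: this row = K + the
definition of the correction bit (REF1 §86 e3 `e3_Z_of_K : GluedPairDiscrepancyIsKummerClassAtTwo → GluedPairCorrectionBitVanishesAtTwo`, kernel) — no
content beyond K, kept as a named support row; `gmDisc ≠ 0` decoration (r1); **PROVED**: `gluedPairCorrectionBitVanishesAtTwo_holds` in
`F1Sign2/ParitySymbolCocycleAtTwoProofs.lean` (p621018; standard axioms). [cite: Kramer1981, Thm. 1] -/
def GluedPairCorrectionBitVanishesAtTwo : Prop :=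
  ∀ (a b c : ℤ), c ≠ 0 → gmDisc a b c ≠ 0 →
    ∀ [Fact (Irreducible (twoDivisionUCubic (gmCurve a b c)))] [Fact (Irreducible (twoDivisionUCubic (gmPartner a b c)))]
      (ψ : twoDivisionAlgebra (gmPartner a b c) →ₐ[ℚ] twoDivisionAlgebra (gmCurve a b c)),
      ψ (twoDivisionRoot (gmPartner a b c)) * twoDivisionRoot (gmCurve a b c) =
        algebraMap ℚ (twoDivisionAlgebra (gmCurve a b c)) (16 * c : ℚ) →
      (∀ (p : ℕ) [Fact p.Prime] (dp cp : ℕ),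
          IsLocalParitySymbolAt (gmCurve a b c) ℚ_[p] (InExplicitLocalKummerImageAtTwo (gmCurve a b c) p)
            (InTransportedKummerImageAtTwo (gmCurve a b c) (gmPartner a b c) ψ p)
            (thetaDiscrepancyAtTwo (gmCurve a b c) (gmPartner a b c) ψ) dp cp → cp = 0) ∧
        ∀ (d₀ c₀ : ℕ),
          IsLocalParitySymbolAt (gmCurve a b c) ℝ
            (InRealKummerImageAtTwo (gmCurve a b c) (twoDivisionUCubic (gmCurve a b c)) (twoDivisionRoot (gmCurve a b c)))
            (InRealKummerImageAtTwo (gmCurve a b c) (twoDivisionUCubic (gmPartner a b c)) (ψ (twoDivisionRoot (gmPartner a b c))))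
            (thetaDiscrepancyAtTwo (gmCurve a b c) (gmPartner a b c) ψ) d₀ c₀ → c₀ = 0

/-! ## §C (g14). Green–Maistret's `(2,2)`-isogeny local term IS Kramer's intersection parity times `(−1,−1)_v` -/

/-- **DESC-§22-L (LEAD of g14; THEOREM ON PAPER = Green–Maistret 2022 Thm 2.11 [print] + the identification `λ_{f,K} =
(−1)^{d_K(E_f,E′_f)}·(−1,−1)_K` [MEMO-desc §22.5: Kummer naturality for `φᵗ : Jac C_f → E_f × E′_f`, `Im δ_{φᵗ} = W_E + ψ^*W_{E′}`,
`#ker = #M(K)`, `e_K = ord₂‖2‖_K⁻¹`, `(−1)^{e_K} = (−1,−1)_K`, `μ_{C_f/K} = 1`]; a plain def, nothing asserted).** For the glued pair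
`E = E_f`, `F = E′_f` (`c ≠ 0`, `Δ_f ≠ 0`, both cubics irreducible, `ψ(θ_F)θ_E = 16c`), a prime `p` with both local root numbers non-junk,
and `(d_p, c_p)` the §20 local parity symbol:  `(−1)^{d_p} · w_p(E_f) · w_p(E′_f) = (−1,−1)_p · 𝓔_p(f)` — KRAMER's intersection term
`d_p = dim(δ_p(E)+δ_p(E′)) − dim δ_p(E)` of the congruent (non-twist!) pair governs the root-number product exactly as the norm index does
for twists (Kramer–Tunnell), with GM's Hilbert-symbol gauge `𝓔` and the constant `(−1,−1)_p`.  This is the `d = 1` case of DESC-§21-G with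
`c_p = 0` (DESC-§22-Z) made explicit; it answers GM's «no conceptual understanding of the local discrepancy» (arXiv 2110.06718 p. 14) for
their own `λ`: `λ_{f,K}·(−1,−1)_K` is the parity of the Kummer intersection codimension.  WHY IT MIGHT FAIL: only through the explicit
dictionary (`HasLocSqDimAt` of the explicit Kummer predicates = `dim W`; junk `localRootNumberAt = 0` excluded by hypothesis).
[cite: GreenMaistret2022, Def. 1.11, Lemma 2.3, Lemma 2.6, Def. 2.8, Thm. 2.11] [cite: Kramer1981, Thm. 1, Prop. 7]
[cite: DokchitserDokchitser2011Crelle, Thm. 5 (Kramer–Tunnell)] [cite: PoonenRains2012, Prop. 4.10, Thm. 4.13]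
PLACEMENT (REF2 v20-add1 §2, rider r1): VARIANT, IN-PRINT ASSEMBLY (corollary-grade) — the Kummer step `Im δ_{φᵗ} = W_E + ψ^*W_{E′}` (coker of the
glued dual isogeny on `K`-points = sum of the Kummer images) is Bruin 2004, Thm. 3.1(c) (any `m`, any field of characteristic `0`; global Selmer identities
`S^{(φ)}(A) = S²(E) + S²(E′)`, `S^{(φ̂)}(E×E′) = S²(E) ∩ S²(E′)`, §1); with the local Euler characteristic `#E(K)/2E(K) = #E(K)[2]·‖2‖_K⁻¹`,
`(−1,−1)_K = (−1)^{[K:ℚ₂]}` and the ker-coker normalisation of `λ` (Green–Maistret Def. 1.11 = Dokchitser–Maistret 2023 §1.3) the identity follows in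
three lines; twist case = Kramer 1981 (norm index = Kummer-intersection codimension). Not printed as a sentence (Green–Maistret compute `λ` via Tamagawa
numbers, Lemma 2.6); it identifies the constant `(−1,−1)_v` as a change of normalisation and does NOT explain `𝓔_K(f)` — their remark after Thm. 2.11
stands (rider r3; REF1 §86 rider r7 concurs: Thm 2 explains the cell's `(−1,−1)_v` as the normalisation change `d_K ↔ ker/coker`, not `𝓔_K(f)`).
To be closed by a PROOF (prover item; theorem, not candidate). REF1 §86 (THEOREM ON PAPER, CLEARED as a plain def; every step of THEOREM 2 checked
against GM Def. 1.11 / Lemma 2.3, step (b) = Bruin 2004 Thm 3.1(c)); rider r3: `cp` is DECORATION — the symbol's `c` is a function of the data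
(REF1 §86 e1 `e1_symbol_c_functional`), so this row is equivalent to its `cp`-free form, and `d` is unique whenever a symbol exists (`HasLocSqDimAt` pins
`dim ⟨D⟩`); the constant `(−1,−1)_p` = REF1 §86 e8; rider r1: here `gmDisc a b c ≠ 0` is load-bearing (`Δ_f` enters `𝓔_{ℚ_p}(f)`).
REF2 v21 §1.3: VARIANT, in-print assembly = Bruin 2004 Thm. 3.1(c) + the generic `#coker/#ker` index bookkeeping for a Richelot-type pair
(Cassels–Flynn ch. 10) + GM Def. 1.11; Konstantinou (JNT 2025) Prop. 4 / Thm. 17 (regulator constants, `(2,2)`-split Jacobian) is a neighbour cite only.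
[cite: Bruin2004, Thm. 3.1(c), §1] [cite: DokchitserMaistret2023, §1.3] [cite: CasselsFlynn1996, Ch. 10] -/
def GreenMaistretLambdaIsKramerParityAtTwo : Prop :=
  ∀ (a b c : ℤ), c ≠ 0 → gmDisc a b c ≠ 0 →
    ∀ [Fact (Irreducible (twoDivisionUCubic (gmCurve a b c)))] [Fact (Irreducible (twoDivisionUCubic (gmPartner a b c)))]
      (ψ : twoDivisionAlgebra (gmPartner a b c) →ₐ[ℚ] twoDivisionAlgebra (gmCurve a b c)),
      ψ (twoDivisionRoot (gmPartner a b c)) * twoDivisionRoot (gmCurve a b c) =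
        algebraMap ℚ (twoDivisionAlgebra (gmCurve a b c)) (16 * c : ℚ) →
    ∀ (p : ℕ) [Fact p.Prime] (v : HeightOneSpectrum ℤ), Rat.HeightOneSpectrum.natGenerator v = p →
      (gmCurve a b c).localRootNumberAt v ≠ 0 → (gmPartner a b c).localRootNumberAt v ≠ 0 →
    ∀ (dp cp : ℕ),
      IsLocalParitySymbolAt (gmCurve a b c) ℚ_[p] (InExplicitLocalKummerImageAtTwo (gmCurve a b c) p)
        (InTransportedKummerImageAtTwo (gmCurve a b c) (gmPartner a b c) ψ p)
        (thetaDiscrepancyAtTwo (gmCurve a b c) (gmPartner a b c) ψ) dp cp →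
      (-1 : ℤ) ^ dp * (gmCurve a b c).localRootNumberAt v * (gmPartner a b c).localRootNumberAt v =
        localSign p (-1) (-1) * gmGaugeAt p a b c

/-- **DESC-§22-L∞ (theorem-grade; GM Prop. 3.2 + §22.5 at `K = ℝ`: `e_ℝ = −1`, `(−1,−1)_ℝ = −1`, `w_∞ w_∞′ = 1`).** Real place of
DESC-§22-L: `(−1)^{d_∞(E_f,E′_f)} = −𝓔_ℝ(f)`; for three real roots `d_∞ = 1` iff at least two roots of `f` are negative, for one real
root `d_∞ = 0` and `𝓔_ℝ(f) = −1`. [cite: GreenMaistret2022, Prop. 3.2] [cite: BrumerKramer1977, §2] -/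
def GreenMaistretLambdaIsKramerParityAtInfinity : Prop :=
  ∀ (a b c : ℤ), c ≠ 0 → gmDisc a b c ≠ 0 →
    ∀ [Fact (Irreducible (twoDivisionUCubic (gmCurve a b c)))] [Fact (Irreducible (twoDivisionUCubic (gmPartner a b c)))]
      (ψ : twoDivisionAlgebra (gmPartner a b c) →ₐ[ℚ] twoDivisionAlgebra (gmCurve a b c)),
      ψ (twoDivisionRoot (gmPartner a b c)) * twoDivisionRoot (gmCurve a b c) =
        algebraMap ℚ (twoDivisionAlgebra (gmCurve a b c)) (16 * c : ℚ) →
    ∀ (d₀ c₀ : ℕ),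
      IsLocalParitySymbolAt (gmCurve a b c) ℝ
        (InRealKummerImageAtTwo (gmCurve a b c) (twoDivisionUCubic (gmCurve a b c)) (twoDivisionRoot (gmCurve a b c)))
        (InRealKummerImageAtTwo (gmCurve a b c) (twoDivisionUCubic (gmPartner a b c)) (ψ (twoDivisionRoot (gmPartner a b c))))
        (thetaDiscrepancyAtTwo (gmCurve a b c) (gmPartner a b c) ψ) d₀ c₀ →
      (-1 : ℤ) ^ d₀ = -gmGaugeInfty a b c

/-! ## §D (g14). The parity-transfer symbol is a groupoid cocycle: transvection formula and cocycle law -/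

/-- **DESC-§22-A (support; theorem-grade — six-line proof, MEMO-desc §22.3; brute-forced over all configurations for `dim V ≤ 4` and
20 000 samples at `dim V = 6`, 0 exceptions).** THE TRANSVECTION FORMULA over `𝔽₂`.  `V` finite-dimensional, `B` alternating
non-degenerate, `q` a quadratic refinement (`q(x+y) = q x + q y + B x y`), `W₁` with `q|_{W₁} = 0`, `u` with `q u = 0`, `W₂` with
`(q + B u ·)|_{W₂} = 0`, both of half dimension; `τ_u x = x + B(x,u) u`; `c = 1` iff `u ∉ W₁ ∪ W₂` and `u = a + b` (`a ∈ W₁`, `b ∈ W₂`)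
with `q b ≠ 0` (well defined).  Then `dim(W₁ ∩ τ_u W₂) = dim(W₁ ∩ W₂) + c`.  Consequence: the §20 local parity symbol
`κ_v = d_v + c_v ≡ n − dim(δ_v(E) ∩ τ_{u_v} δ_v(F))` is the ruling distance of two Lagrangians of ONE quadratic space.
[cite: PoonenRains2012, Prop. 4.10, Rem. 4.14 (arXiv numbering)] [cite: KlagsbrunMazurRubin2013, Thm. 3.9 (ruling parity, twists)]
PLACEMENT (REF2 v20-add1 §2, rider r2): KNOWN-type — classical `𝔽₂` quadratic-form algebra (the two rulings of maximal isotropic subspaces; Dickson invariant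
`d_q(σ) = dim V^σ mod 2`: Dye 1977, Morgan 2019 Prop. 10; Pollatsek 1971 and Morgan 2019 Construction 11 for the extension to `Sp(V)`); no novelty claim.
**PROVED**: `transvectionRulingFormulaF2_holds` in `F1Sign2/ParitySymbolCocycleAtTwoProofs.lean` (p621018; -desc `Transvection.lean` d1332845eae42874
verbatim; REF1 §86 «theorem in the kernel»; standard axioms); rider r4: `c` is well
defined — two decompositions `u = a + b` differ by `z ∈ W₁ ∩ W₂ ⊂ u^⊥` (Lemma A exhaustive for `n ≤ 3`: 36 036 cases, 0 violations); the hypotheses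
`q u = 0`, non-degeneracy, polarisation and half-dimension are NOT used by the kernel proof (harmless over-hypothesising, kept for readability); junk end
`u = 0`: `c = 0`, `τ₀ = id` (REF1 §86 e5). [cite: Morgan2019, Prop. 10, Construction 11] -/
def TransvectionRulingFormulaF2 : Prop :=
  ∀ (V : Type) [AddCommGroup V] [Module (ZMod 2) V] [FiniteDimensional (ZMod 2) V]
    (B : V →ₗ[ZMod 2] V →ₗ[ZMod 2] ZMod 2) (q : V → ZMod 2),
    (∀ x, B x x = 0) → (∀ x, (∀ y, B x y = 0) → x = 0) → (∀ x y, q (x + y) = q x + q y + B x y) →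
    ∀ (W₁ W₂ : Submodule (ZMod 2) V) (u : V),
      q u = 0 → (∀ x ∈ W₁, q x = 0) → (∀ x ∈ W₂, q x + B u x = 0) →
      2 * Module.finrank (ZMod 2) W₁ = Module.finrank (ZMod 2) V →
      2 * Module.finrank (ZMod 2) W₂ = Module.finrank (ZMod 2) V →
      ∀ (c : ℕ),
        (c = if (u ∉ W₁ ∧ u ∉ W₂ ∧ ∃ a ∈ W₁, ∃ b ∈ W₂, u = a + b ∧ q b ≠ 0) then 1 else 0) →
        Module.finrank (ZMod 2) ↥(W₁ ⊓ W₂.map (LinearMap.id + (B.flip u).smulRight u)) =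
          Module.finrank (ZMod 2) ↥(W₁ ⊓ W₂) + c

/-- **DESC-§22-C (LEAD conjecture-grade AS TYPED over the explicit dictionary; THEOREM ON PAPER, MEMO-desc §22.4; census = BC5 witness,
kit j303408 (smoke: 12 triples / 50 place rows, cocycle 50/50 with 12 non-zero defects, two defect engines agree 50/50, reciprocity 12/12)
and j303550 (full: 22 190 triples of Cremona curves in 302 `S₃`-cubic fields)).** THE COCYCLE LAW OF THE PARITY-TRANSFER SYMBOL.  For three
curves with irreducible `2`-division cubics and congruences `ψ₁₂ : L₂ → L₁`, `ψ₂₃ : L₃ → L₂` (and `ψ₁₃ = ψ₁₂ ∘ ψ₂₃`), at every prime `p`: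
`κ_p(E₁,E₂) + κ_p(E₂,E₃) + κ_p(E₁,E₃) ≡ [S_{ψ₁₂(u₂₃), E₁} is ANISOTROPIC over ℚ_p]` — the defect is the local Tate pairing
`⟨u₁₂, u₂₃⟩_p = ⟨u₁₂, u₁₃⟩_p` (`= q_{E₁,p}(ψ₁₂u₂₃)` by polarisation and DESC-§20-I), non-zero in 12/50 smoke rows; summed over all places it
vanishes (Hilbert reciprocity in `L₁`), recovering the consistency of DESC-§20-P around the triangle.  Proof: transvection formula (DESC-§22-A)
+ `τ_uτ_wτ_{u+w} ∈ O(q₁)` has Dickson invariant `⟨u,w⟩`.  WHY IT MIGHT FAIL: as typed only through the explicit dictionary (conic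
normalisation at `p = 2`; `HasLocSqDimAt` pins); the `𝔽₂`-statement is proved. PLACEMENT (REF2 v20-add1 §2, rider r2): NEW-COMBINATION (small) —
the structure «parity 1-cochain whose coboundary is the pairing of the form-change classes» is in print for the symplectic GROUP (Morgan 2019 Prop. 14,
`df_q = c_q ∪ c_q`, after Pollatsek 1971), applied to `2`-Selmer disparity in quadratic-twist families of principally polarised abelian varieties;
Klagsbrun–Mazur–Rubin 2013 Thm. 3.9 is the case `u = 1`; the present GROUPOID-of-congruences form (distinct curves with `E[2] ≅ M`, form-change classes =
Poonen–Rains theta discrepancies, defect `⟨u₁₂,u₂₃⟩_v` read as conic isotropy) was not found verbatim in print; globally `Σ_v ⟨u₁₂,u₂₃⟩_v = 0` is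
reciprocity (no new global parity content); beyond-print theorem: yes-small, corollary-grade. REF1 §86: THEOREM ON PAPER over the explicit dictionary,
CLEARED conjecture-grade AS TYPED; the `𝔽₂` core (Lemma A + Theorem 3 + Dickson step) verified exhaustively (216 + 216 000 configurations for `n = 1, 2`,
40 000 samples at `n = 3`, Dickson 19 901; 0 violations); rider r5: the third symbol is taken along `ψ₁₂ ∘ ψ₂₃` and `u₁₃ ≡ u₁₂ · ψ₁₂(u₂₃)` modulo
squares (REF1 §86 e7 `e7_thetaDiscrepancy_comp`, kernel) — the composite convention is forced; the defect reading «sum even ↔ `S_{ψ₁₂(u₂₃),E₁}`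
isotropic» is correctly oriented (`q₁(ψ₁₂u₂₃) = ⟨u₁₂,u₂₃⟩`). PLACEMENT UPDATE (REF2 v21 §1, all six neighbours opened; Klagsbrun–Mazur–Rubin 2013
first-hand): the defect-free TRIANGLE LAW for three Lagrangians of ONE quadratic space is KMR 2013 Cor. 5 (arXiv numbering; elliptic curves, this
problem) and Morgan 2015 (arXiv 1504.01960) Lemma 14 (quadratic twists of one p.p.a.v.); the `p = 2` move `q₂ = q₁ + ⟨u₁₂, ·⟩` IS in print as KMR
Remark 10; KMR Thm. 14 (= Annals Thm. 3.9) is the `u = 1` comparison; the defect cochain is Morgan 2019 Prop. 14. Not sources for the law: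
Konstantinou (JNT 2025, arXiv 2311.02137) Prop. 4 / Thm. 17 = regulator constants for the `(2,2)`-split Jacobian (neighbour cite for row L only),
Yan (arXiv 2109.08257) Rem. 2.2 EXCLUDES the split case `Δ = 0`, Cassels–Flynn ch. 10/14 = generic isogeny index / geometry of reducible Jacobians.
JOINT REF1 §86 + REF2 v21-add1 §1 LINE: NEW-COMBINATION (small) — not in print as stated, not refuted in print; beyond-print theorem YES-SMALL,
corollary-grade, ON PAPER (not in the kernel); no new global parity content.
[cite: PoonenRains2012, Cor. 4.6, Prop. 4.10] [cite: KlagsbrunMazurRubin2013, Cor. 5, Rem. 10, Thm. 14 (arXiv numbering) = Thm. 3.9] [cite: GreenMaistret2022, Thm. 1.3]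
[cite: Morgan2019, Prop. 14] [cite: CasselsFlynn1996, Ch. 10, Ch. 14] -/
def LocalParitySymbolCocycleAtTwo : Prop :=
  ∀ (E₁ E₂ E₃ : WeierstrassCurve ℚ) [E₁.IsElliptic] [E₂.IsElliptic] [E₃.IsElliptic]
    [Fact (Irreducible (twoDivisionUCubic E₁))] [Fact (Irreducible (twoDivisionUCubic E₂))] [Fact (Irreducible (twoDivisionUCubic E₃))]
    (ψ₁₂ : twoDivisionAlgebra E₂ →ₐ[ℚ] twoDivisionAlgebra E₁) (ψ₂₃ : twoDivisionAlgebra E₃ →ₐ[ℚ] twoDivisionAlgebra E₂)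
    (p : ℕ) [Fact p.Prime] (d₁₂ c₁₂ d₂₃ c₂₃ d₁₃ c₁₃ : ℕ),
    IsLocalParitySymbolAt E₁ ℚ_[p] (InExplicitLocalKummerImageAtTwo E₁ p) (InTransportedKummerImageAtTwo E₁ E₂ ψ₁₂ p)
      (thetaDiscrepancyAtTwo E₁ E₂ ψ₁₂) d₁₂ c₁₂ →
    IsLocalParitySymbolAt E₂ ℚ_[p] (InExplicitLocalKummerImageAtTwo E₂ p) (InTransportedKummerImageAtTwo E₂ E₃ ψ₂₃ p)
      (thetaDiscrepancyAtTwo E₂ E₃ ψ₂₃) d₂₃ c₂₃ →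
    IsLocalParitySymbolAt E₁ ℚ_[p] (InExplicitLocalKummerImageAtTwo E₁ p) (InTransportedKummerImageAtTwo E₁ E₃ (ψ₁₂.comp ψ₂₃) p)
      (thetaDiscrepancyAtTwo E₁ E₃ (ψ₁₂.comp ψ₂₃)) d₁₃ c₁₃ →
    (Even (d₁₂ + c₁₂ + d₂₃ + c₂₃ + d₁₃ + c₁₃) ↔ ConicIsotropicAt E₁ ℚ_[p] (ψ₁₂ (thetaDiscrepancyAtTwo E₂ E₃ ψ₂₃)))

/-- **DESC-§22-C∞ (same law at the real place; theorem on paper).** With the real Kummer conditions (`InRealKummerImageAtTwo`) and the conic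
over `ℝ`: `κ_∞(E₁,E₂) + κ_∞(E₂,E₃) + κ_∞(E₁,E₃) ≡ [S_{ψ₁₂(u₂₃),E₁}(ℝ) = ∅]` (`= 1` iff `u₁₂` and `u₁₃` are both negative at an odd number of
real places of `L₁`; `0` when `L₁` has one real place). Placement = row C's (REF1 §86 + REF2 v21-add1 §1: NEW-COMBINATION (small), theorem on
paper). [cite: PoonenRains2012, Cor. 4.6] [cite: BrumerKramer1977, §2] -/
def LocalParitySymbolCocycleAtInfinity : Prop :=
  ∀ (E₁ E₂ E₃ : WeierstrassCurve ℚ) [E₁.IsElliptic] [E₂.IsElliptic] [E₃.IsElliptic]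
    [Fact (Irreducible (twoDivisionUCubic E₁))] [Fact (Irreducible (twoDivisionUCubic E₂))] [Fact (Irreducible (twoDivisionUCubic E₃))]
    (ψ₁₂ : twoDivisionAlgebra E₂ →ₐ[ℚ] twoDivisionAlgebra E₁) (ψ₂₃ : twoDivisionAlgebra E₃ →ₐ[ℚ] twoDivisionAlgebra E₂)
    (d₁₂ c₁₂ d₂₃ c₂₃ d₁₃ c₁₃ : ℕ),
    IsLocalParitySymbolAt E₁ ℝ (InRealKummerImageAtTwo E₁ (twoDivisionUCubic E₁) (twoDivisionRoot E₁))
      (InRealKummerImageAtTwo E₁ (twoDivisionUCubic E₂) (ψ₁₂ (twoDivisionRoot E₂))) (thetaDiscrepancyAtTwo E₁ E₂ ψ₁₂) d₁₂ c₁₂ →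
    IsLocalParitySymbolAt E₂ ℝ (InRealKummerImageAtTwo E₂ (twoDivisionUCubic E₂) (twoDivisionRoot E₂))
      (InRealKummerImageAtTwo E₂ (twoDivisionUCubic E₃) (ψ₂₃ (twoDivisionRoot E₃))) (thetaDiscrepancyAtTwo E₂ E₃ ψ₂₃) d₂₃ c₂₃ →
    IsLocalParitySymbolAt E₁ ℝ (InRealKummerImageAtTwo E₁ (twoDivisionUCubic E₁) (twoDivisionRoot E₁))
      (InRealKummerImageAtTwo E₁ (twoDivisionUCubic E₃) ((ψ₁₂.comp ψ₂₃) (twoDivisionRoot E₃)))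
      (thetaDiscrepancyAtTwo E₁ E₃ (ψ₁₂.comp ψ₂₃)) d₁₃ c₁₃ →
    (Even (d₁₂ + c₁₂ + d₂₃ + c₂₃ + d₁₃ + c₁₃) ↔ ConicIsotropicAt E₁ ℝ (ψ₁₂ (thetaDiscrepancyAtTwo E₂ E₃ ψ₂₃)))

/-! ## §B-add (g14 ADDENDUM 4, MEMO-desc §22.13 THEOREM 4): the theta-discrepancy of the glued pair DETECTS THE MARKED POINT — rows DESC-§22-V, -V′

TYPER APPEND (-ty g8; -desc CANDIDATES-delta 2026-08-28T09:28:01Z «append to the glued-pair block or a sibling — your call»: appended here, the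
module stays statement-only but for -desc's three-line non-vacuity lemma): bodies VERBATIM from `HOME/MEMO-desc-data/g14/lean/Sketch-v19V.lean`
805b155533ae6839 (ns `…SketchV19` there; farm rc 0 · 0 sorry; BC7 `#h21_crux_probe` 2/2 CLEAN `Sketch-v19V.probe.txt` 3ef27784eb165616); cite keys
mapped to the tree's entries for the same works (`Bruin2004VisualisingSha2` ↦ `Bruin2004` = Math. Comp. 73 (2004); `Silverman2009AEC` ↦ `SilvermanAEC2009`
= GTM 106, 2nd ed.); builder `tools/mk_desc22v.py` (published under `HOME/MEMO-ty-data/g8/`).  THEOREM 4 (MEMO-desc §22.13): (i) `u ≡ ψ μ′((0,c))`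
[kernel: rows U/K, p620606/p621018]; (ii) `u ∈ ψ Sel₂(E′_f)` always; (iii) `u ∈ L_E^{×2} ⟺ (0,c) ∈ 2E′_f(ℚ)` (row V); (iv) `u ∉ □ ⇒ (0,c)` has infinite
order ⇒ `rk E′_f ≥ 1` (row V′); (v) `[u] ∈ H¹(ℚ,E_f)` is visible in `J_f = (E_f × E′_f)/Δ_ψ = Jac(y² = f(x²))`.  CENSUS (BC5 witness, falsifier RUN):
g13 ALL5 j302066, 757 square-`d` Cremona pairs: `u ∈ Sel` 757/757; `u ∉ □` ⇒ partner Cremona rank ≥ 1 in 578/578 (rank 1/2/3 = 366/210/2); `u ∈ □`: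
partner rank 0/1/2 = 23/131/25 (23/23 rank-0 partners have `u ∈ □`); kit smoke j304540 15/15 exact `[u ∈ □] = ellisdivisible((0,c_r),2)`; kit FULL
j304550 (≈ 12 981 glued pairs) running at 09:28Z — numbers in MEMO-desc §22.13-add.  PROOFS: -desc g14 ADDENDA 5/6 (09:39Z, 09:49Z)
`MarkedPoint.lean` 39fea69b4f1f29aa proves BOTH rows (Cassels halving over `AdjoinRoot`); they land as further `…Proofs` siblings after this append.  PARTITION: none; beyond-print theorem: no (VARIANT identification, -desc's own reading). -/

/-- **DESC-§22-V (support; theorem on paper: MEMO-desc §22.2 Thm 1 = rows U/K (kernel-proved) + injectivity of the `2`-descent map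
`μ′ : E′(ℚ)/2E′(ℚ) ↪ L_{E′}^×/L_{E′}^{×2}`, `(x,y) ↦ x − θ′` [Cassels; Silverman X.1.4]; census = BC5 witness: g13 ALL5 Cremona pairs with square
`d` 757/757 consistent (578 `u ≠ □` ⇒ partner rank ≥ 1, 23 rank-0 partners ⇒ `u = □`), kit j304550 `[u □] = [(0,c_r) ∈ 2E′(ℚ)]`).**
THE THETA-DISCREPANCY IS THE KUMMER CLASS OF THE MARKED POINT, EXACTLY: for the Green–Maistret glued pair `E_f = ⟨0,a,0,b,c⟩`, `E′_f = ⟨0,b,0,ac,c²⟩`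
(`c ≠ 0`, `Δ_f ≠ 0`, both `2`-division cubics irreducible) and the pinned congruence `ψ` (`ψ(θ_{E′})·θ_E = 16c`), the theta-discrepancy
`u = c_E′(θ_E)·ψ(c_{E′}′(θ_{E′}))` is a square in `L_E` IF AND ONLY IF the marked rational point `T₀ = (0,c)` of `E′_f` is divisible by `2` in
`E′_f(ℚ)`.  REF1 §89 rider r1 (explicit form): both sides ⟺ `∃ m ∈ ℤ, (m² − b)² = 4c(a + 2m)` — the tangent to `E′_f` through `−T₀` (REF1 §89
e3/e4/e4′; 13 608-triple check, 0 mismatches); rider r2: `gmDisc a b c ≠ 0` is implied by the two irreducibility Facts, kept for uniformity with U/K/Z;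
rider r4: `Q + Q = 2 • Q` (`two_nsmul`).  PROVED by -desc g14 (`MarkedPoint.lean` 39fea69b4f1f29aa: `thetaDiscrepancySquareIffMarkedPointHalvesAtTwo_holds`,
Cassels halving over `AdjoinRoot` with the explicit half `Q = (α₁/(4α₂) − b, −1/(8α₂))`) — lands in the part-3/4 `…Proofs` siblings, closing this row BY NAME.
WHY IT MIGHT FAIL: only through a slip in the dictionary (`u ≡ −ψ(θ_{E′}) ≡ ψ(μ′(T₀))` modulo squares is kernel-proved; `⇐` is the
duplication-formula identity `x(2Q) − θ′ = □`; `⇒` is the injectivity of `μ′`, which needs `c_{E′}` irreducible — supplied).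
REF1-AUDIT §89 (b) (refuter seat bsd-f1-sign2-ref1 g8, 2026-08-28T09:41:57Z; D-desc-ref1-23 ANSWERED; evidence `HOME/REF1-data/b89/` Probe89.lean 007161be9107d975 =
§B-add VERBATIM + e1–e5, farm rc 0 · 0 warn · 0 sorry; this append e66f0ff60eaab6ab recompiled rc 0, §B-add 3/3 SAME vs Sketch-v19V 805b155533ae6839, support
axioms trio): **-ty FILING GATE CLEARED to file as is.** Row V = THEOREM ON PAPER, statement faithful, non-vacuous, CLEARED as plain def — route 1 = rows U/K
(kernel) + `ψ` bijective (e2, kernel) + Cassels LMSST §15 Lemma 2 «the kernel of μ is 2𝔊» (read first-hand, p. 42–43); route 2 (REF1's, explicit): BOTH sides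
⟺ `∃ m ∈ ℤ, (m² − b)² = 4c(a + 2m)` — the tangent to `E′_f` through `−T₀` (e3 sextic factorisation, e4 tangent substitution, e4′ coefficient match over ℤ,
kernel); independent PARI-free check `v_check.py`: all `|a|,|b|,|c| ≤ 12`, `c ≠ 0`, `f, g` irreducible = 13 608 triples, (i) `∃ m` [= `T₀ ∈ 2E′(ℚ)`] vs
(ii) `−θ′` locally square at every prime < 400: 13 608/13 608 agree, 0 mismatches (504 halvable; torsion family `(a,b) = (−4,4)`: `3T₀ = 0`). Row V′ = V +
«`E′(ℚ)[2] = 0` ⇒ odd torsion ⇒ 2-divisible» (e1/e1′ kernel) — CLEARED; the `E′`-irreducibility Fact is LOAD-BEARING for V′; `gmDisc ≠ 0` is implied by the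
two Facts (`disc g = c²·disc f`; harmless, uniform). Binder order = rows U/K/Z's + `h` last; `¬ IsOfFinAddOrder` IS «infinite order»; `∃ h` is inhabited by
the support lemma (so `∀ h ≡ ∃ h`); `Q + Q = 2 • Q` by `two_nsmul` (by-name closure indifferent). Riders r1–r4 docstring-level, optional (folded below).
PARTITION: none; beyond-print theorem: no.
REF2-PLACEMENT v22 §2 (refuter seat bsd-f1-sign2-ref2 g22, 2026-08-28T09:40:06Z; D-desc-ref2-23 ANSWERED; register 7ef3837e97120b82): V / V′ = **VARIANT /
IN-PRINT ASSEMBLY (corollary-grade); beyond-print NO; PARTITION none.** In print as: Bruin 2004 §5 (explicit `μ₂` on `y² = x f(x)`; `μ₂(∞) = dF(a)(a − θ)`,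
here `(a,d) = (0,1)`, `∞ ↔ T₀ = (0,c)` on `E′_f` under `(x,y₁) ↦ (c/x, c y₁/x²)`) composed with Cassels 1991 §15 Lemma 2 (`ker μ = 2E(K)`); V′ adds Bruin 2004
Cor. 3.4 / Thm. 3.1(c); `E′_f(ℚ)[2] = 0` is in the binders. kit j304550, when posted, is BC5 evidence only.
BC5 UPDATE 9 (-desc g14 §22.13-add4, 2026-08-28T11:38:02Z; kit j305814 T4 EXACT RUN COMPLETE — 1 574 rank-0 curves → 4 594 glued pairs, JOB_PMAX 10^15 ⇒ nbig = 0, 0 ERROR/TIMEOUT; `HOME/MEMO-desc-data/g14/job-j305814/` GM10.out.gz cd0f1bc1, CENSUS10.txt 41a539f1; supersedes the j304550 partial 2 232/2 232 folded earlier): T1 `[u □] = [(0,c) ∈ 2E′(ℚ)]` (row V, engine check of the theorem) 4 594/4 594, 0 mismatches ((1,1) ×111 / (0,0) ×4 483); T2 (row V′/H‴ instances) 4 483/4 483; T3 4 594/4 594; LAW ok; B2 falsifier 0/9 278; T4: exactly 4 certified instances of `0 ≠ u ∈ Ш(E)[2]` visible on the marked partner — 1701i1, 3575e1, 5445a1,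 7300c1 (two engines 4/4: all bad primes tested ∧ PARI `ellrank(E) = [0,0,2]`; partners N = 34 020/14 300/21 780/14 600 of rank 2/1/2/2, the partner's `(0,c)` of infinite order explains `u`, Bruin 2004 Thm 3.1 at `(a,d) = (0,1)`); REF1 §102 (12:00:49Z): every number REPRODUCES from GM10.out.gz with an independent parser; REF2 v23: no grade change possible (assembly rows).
[cite: GreenMaistret2022, Lemma 6.3] [cite: Bruin2004, Thm. 3.1, §5, Cor. 3.4] [cite: SilvermanAEC2009, Prop. X.1.4] [cite: Cassels1991, §15 Lemma 2] -/
def ThetaDiscrepancySquareIffMarkedPointHalvesAtTwo : Prop :=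
  ∀ (a b c : ℤ), c ≠ 0 → gmDisc a b c ≠ 0 →
    ∀ [Fact (Irreducible (twoDivisionUCubic (gmCurve a b c)))] [Fact (Irreducible (twoDivisionUCubic (gmPartner a b c)))]
      (ψ : twoDivisionAlgebra (gmPartner a b c) →ₐ[ℚ] twoDivisionAlgebra (gmCurve a b c)),
      ψ (twoDivisionRoot (gmPartner a b c)) * twoDivisionRoot (gmCurve a b c) =
        algebraMap ℚ (twoDivisionAlgebra (gmCurve a b c)) (16 * c : ℚ) →
    ∀ (h : (gmPartner a b c).toAffine.Nonsingular 0 (c : ℚ)),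
      (IsSquare (thetaDiscrepancyAtTwo (gmCurve a b c) (gmPartner a b c) ψ) ↔
        ∃ Q : (gmPartner a b c).toAffine.Point, Q + Q = WeierstrassCurve.Affine.Point.some 0 (c : ℚ) h)

/-- **DESC-§22-V′ (RANK DETECTION; corollary of DESC-§22-V: `E′_f(ℚ)[2] = 0` since `c_{E′}` is irreducible, so a point not divisible by `2`
has infinite order).** If `u_{E_f,E′_f}` is NOT a square in `L_E`, the marked point `(0,c) ∈ E′_f(ℚ)` has infinite order; in particular
`E′_f(ℚ)` is infinite (`rk E′_f ≥ 1`) — a descent-free rank certificate read off one square class.  Census: 578/578 Cremona partners (g13 ALL5,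
square `d`, `u ≠ □`) have rank ≥ 1 (366 rank 1, 210 rank 2, 2 rank 3); the 23 rank-0 partners all have `u = □`.  REF1 §89: CLEARED (= V + «`E′(ℚ)[2] = 0`
⇒ odd torsion ⇒ 2-divisible», e1/e1′ kernel); rider r3: the `E′`-irreducibility Fact is LOAD-BEARING here; `¬ IsOfFinAddOrder` is «infinite order»; `∃ h` is
inhabited by `gmPartner_nonsingular_markedPoint` below.  REF2 v22 §2: VARIANT, in-print assembly (adds Bruin 2004 Cor. 3.4 / Thm. 3.1(c)).  PROVED by -desc g14
(`MarkedPoint.thetaDiscrepancyDetectsPartnerRankAtTwo_holds`, kernel, axioms trio) — lands in the part-3 `…Proofs` sibling, closing this row BY NAME.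
[cite: Bruin2004, Cor. 3.4] [cite: Cassels1991, §15 Lemma 2] -/
def ThetaDiscrepancyDetectsPartnerRankAtTwo : Prop :=
  ∀ (a b c : ℤ), c ≠ 0 → gmDisc a b c ≠ 0 →
    ∀ [Fact (Irreducible (twoDivisionUCubic (gmCurve a b c)))] [Fact (Irreducible (twoDivisionUCubic (gmPartner a b c)))]
      (ψ : twoDivisionAlgebra (gmPartner a b c) →ₐ[ℚ] twoDivisionAlgebra (gmCurve a b c)),
      ψ (twoDivisionRoot (gmPartner a b c)) * twoDivisionRoot (gmCurve a b c) =
        algebraMap ℚ (twoDivisionAlgebra (gmCurve a b c)) (16 * c : ℚ) →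
      ¬ IsSquare (thetaDiscrepancyAtTwo (gmCurve a b c) (gmPartner a b c) ψ) →
    ∃ h : (gmPartner a b c).toAffine.Nonsingular 0 (c : ℚ),
      ¬ IsOfFinAddOrder (WeierstrassCurve.Affine.Point.some 0 (c : ℚ) h)

/-- Support (elementary): the marked point `(0,c)` is a nonsingular point of `E′_f` whenever `c ≠ 0` (non-vacuity of the binder `h`). -/
theorem gmPartner_nonsingular_markedPoint (a b c : ℤ) (hc : c ≠ 0) : (gmPartner a b c).toAffine.Nonsingular 0 (c : ℚ) := by
  rw [WeierstrassCurve.Affine.nonsingular_iff']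
  refine ⟨?_, Or.inr ?_⟩
  · rw [WeierstrassCurve.Affine.equation_iff']
    simp [gmPartner]
  · simp [gmPartner, hc]

end Summit.BirchSwinnertonDyer.Rank1Residual.F1Sign2

end
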